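import Summits.KontsevichZagierPeriods.KontsevichZagierPeriods.Theorems.HermiteRigidityReductionRigidityLineReduction
import Summits.KontsevichZagierPeriods.KontsevichZagierPeriods.Theorems.HermiteRigidityReducibleRigidTemplate
import Summits.KontsevichZagierPeriods.KontsevichZagierPeriods.Theorems.HurwitzMicroSectorsNormalFormPrincipleDlogMoves

/-!
# Stub ideation k2 (FAMILY 2 — RESHAPE) for `stub_islandComplement` of crux `ReductionRigidity`
# (stmt-KontsevichZagierPeriods-3407; item form stmt-15935 `IslandComplement`)

Elaboration check of the PROPOSED HELPER LEMMAS of `STUB-IDEAS-stub_islandComplement-2.md`.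
Everything named `helper_*` is a statement only (`sorry`); `multiLevelLineKernel_of` is the
kernel-checked assembly of the helpers into the new island (no `sorry` of its own).
-/

noncomputable section

open MeasureTheory Set

namespace Summit.KontsevichZagierPeriods.HermiteRigidity.ReductionRigidity.IslandComplementIdeas2

open Literature.NumberTheory.Transcendental
open Literature.NumberTheory.Transcendental.KZ
open Summit.KontsevichZagierPeriods.KontsevichZagierPeriods.Theses.HermiteRigidity
  (IslandComplement PadeBoxIslands)
open Summit.KontsevichZagierPeriods.HurwitzMicroSectors.NormalFormPrinciple.PiBox

/-! ## H0 — honesty: given the islands, the stub IS the kernel form of Conjecture 1 -/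

/-- With `PadeBoxIslands` (stmt-15909, candidate proof `padeBoxIslands_proof`) the stub
`IslandComplement` is literally the kernel form `∀ c, eval c = 0 → c ∈ relations` (⇔ summit by
`reductionRigidity_iff_kontsevichZagierPeriods` + `reductionRigidityOfKernelForm_proof`). [folklore] -/
theorem islandComplement_iff_kernelForm (hI : PadeBoxIslands) :
    IslandComplement ↔ ∀ c : FormalRep, KZ.eval c = 0 → c ∈ KZ.relations := by
  unfold IslandComplement
  exact ⟨fun h => h hI.1 hI.2, fun h _ _ => h⟩

/-! ## Plan A — the multi-level weight-one island (all integer levels `N ≥ 2` at once) -/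

/-- **A1 (bridge cube-line → dlog slab)**: `[□¹, β/(N−x)] ≡ [(N−1, N), β/y]` — null boundary
(`of_sub_of_restrict_mem_relations`) + rule 2 with the affine reflection `x ↦ N − x`
(|det| = 1; playbook "Rule (2) move witness", `aff_*` chart lemmas). -/
theorem helper_A1_lineNF_sub_dlog_mem_relations {N : ℕ} (hN : 2 ≤ N) (β : ℚ) (s L : IntegralRep 1)
    (hs : s.domain = cube 1) (hsi : EqOn s.integrand (fun p => (β : ℝ) / ((N : ℝ) - p 0)) (cube 1))
    (hL : L.domain = {x | x 0 ∈ Set.Ioo ((((N : ℚ) - 1 : ℚ)) : ℝ) (((N : ℚ) : ℚ) : ℝ)})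
    (hLi : EqOn L.integrand (fun x => (β : ℝ) / x 0) L.domain) :
    KZ.of s - KZ.of L ∈ KZ.relations := by
  sorry

/-- **A2 (the constant dies; Baker with a constant term)**: a rational constant plus a
`ℤ·ℚ`-combination of logarithms of positive rationals vanishes only if the constant is `0`.
Route: `Dlog.exists_mulBasis` (torsion-free multiplicative basis of the `bᵢ/aᵢ`) then
`Dlog.eq_zero_of_alg_add_sum_mul_log_eq_zero` (from `baker_holds`). [cite: Baker1975, Thm 2.1] -/
theorem helper_A2_ratConst_eq_zero {k : ℕ} (n : Fin k → ℤ) (a b c : Fin k → ℚ) (γ : ℚ)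
    (ha : ∀ i, 0 < a i) (hb : ∀ i, 0 < b i)
    (h : (γ : ℝ) + ∑ i, (n i : ℝ) * (c i : ℝ) * Real.log ((b i : ℝ) / (a i : ℝ)) = 0) : γ = 0 := by
  sorry

/-- **A3 (kernel form on the dlog + rational-constant subgroup)**: presentation of an element of
the closure as a finite `ℤ`-combination (`AddSubgroup.closure` = `ℤ`-span, `mem_span_set'`),
merge the constants into one `[pt, γ]` (`carrier_add`), value `γ + Σ nᵢcᵢ log(bᵢ/aᵢ) = 0`
(`Dlog.value_dlog`) ⇒ `γ = 0` (A2) ⇒ constants are relations (`carrier_zero`) and the dlog part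
is a relation by the LANDED `DlogFactorization.dlog_sum_mem_relations`. -/
theorem helper_A3_dlogConst_kernel :
    ∀ x ∈ AddSubgroup.closure
      ({c : FormalRep | ∃ (L : IntegralRep 1) (a b q : ℚ), 0 < a ∧ a < b ∧
          L.domain = {x | x 0 ∈ Set.Ioo (a : ℝ) b} ∧
          EqOn L.integrand (fun x => (q : ℝ) / x 0) L.domain ∧ c = KZ.of L} ∪
       {c | ∃ (r : IntegralRep 0) (q : ℚ), r.domain = cube 0 ∧
          EqOn r.integrand (fun _ => (q : ℝ)) (cube 0) ∧ c = KZ.of r}),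
      KZ.eval x = 0 → x ∈ KZ.relations := by
  sorry

/-- **A4 = the new island, ASSEMBLED (kernel-checked) from A1 + A3** through the landed closure
template `ReducibleRigidTemplate_proof` and the landed `lineReduction`: Conjecture 1 in kernel
form on the MULTI-LEVEL line sector generated by `[□¹, x^a/(N−x)^m]` for ALL `N ≥ 2`
simultaneously and the rational constants. Strictly larger than hypothesis I₁ of the stub (which is
level by level) and a genuine fragment of its conclusion: e.g. the cross-level kernel element
`[□¹,1/(9−x)] − 2[□¹,1/(3−x)] + [□¹,1/(2−x)]` (`9/8 = (3/2)²/2`). [cite: KontsevichZagier2001, §1.2] -/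
theorem multiLevelLineKernel_of
    (hA1 : ∀ {N : ℕ}, 2 ≤ N → ∀ (β : ℚ) (s L : IntegralRep 1),
      s.domain = cube 1 → EqOn s.integrand (fun p => (β : ℝ) / ((N : ℝ) - p 0)) (cube 1) →
      L.domain = {x | x 0 ∈ Set.Ioo ((((N : ℚ) - 1 : ℚ)) : ℝ) (((N : ℚ) : ℚ) : ℝ)} →
      EqOn L.integrand (fun x => (β : ℝ) / x 0) L.domain → KZ.of s - KZ.of L ∈ KZ.relations)
    (hA3 : ∀ x ∈ AddSubgroup.closure
      ({c : FormalRep | ∃ (L : IntegralRep 1) (a b q : ℚ), 0 < a ∧ a < b ∧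
          L.domain = {x | x 0 ∈ Set.Ioo (a : ℝ) b} ∧
          EqOn L.integrand (fun x => (q : ℝ) / x 0) L.domain ∧ c = KZ.of L} ∪
       {c | ∃ (r : IntegralRep 0) (q : ℚ), r.domain = cube 0 ∧
          EqOn r.integrand (fun _ => (q : ℝ)) (cube 0) ∧ c = KZ.of r}),
      KZ.eval x = 0 → x ∈ KZ.relations) :
    ∀ c ∈ AddSubgroup.closure
      ({c : FormalRep | ∃ (N : ℕ) (r : IntegralRep 1) (a m : ℕ), 2 ≤ N ∧ r.domain = cube 1 ∧
          EqOn r.integrand (fun p => p 0 ^ a / ((N : ℝ) - p 0) ^ m) (cube 1) ∧ c = KZ.of r} ∪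
       {c | ∃ (r : IntegralRep 0) (q : ℚ), r.domain = cube 0 ∧
          EqOn r.integrand (fun _ => (q : ℝ)) (cube 0) ∧ c = KZ.of r}),
      KZ.eval c = 0 → c ∈ KZ.relations := by
  refine ReducibleRigidTemplate.ReducibleRigidTemplate_proof _ _ ?_ hA3
  rintro x (⟨N, r, a, m, hN, hr, hri, rfl⟩ | ⟨r, q, hr, hri, rfl⟩)
  · -- line generator: `lineReduction` to `[β/(N−x)] + [γ]`, then the bridge A1 to a dlog slab
    obtain ⟨β, γ, s₁, s₀, hs₁, hs₁i, hs₀, hs₀i, h⟩ :=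
      lineReduction hN a 1 m r hr fun p hp => by rw [hri hp]; push_cast; ring
    have hN1 : (0 : ℚ) < (N : ℚ) - 1 := by
      have : (2 : ℚ) ≤ (N : ℚ) := by exact_mod_cast hN
      linarith
    have hNN : (N : ℚ) - 1 < (N : ℚ) := by linarith
    obtain ⟨L, hLd, hLi⟩ := Dlog.exists_dlog ((N : ℚ) - 1) (N : ℚ) β hN1
    have hb := hA1 hN β s₁ L hs₁ hs₁i hLd fun y _ => congrFun hLi y
    refine ⟨KZ.of L + KZ.of s₀, AddSubgroup.add_mem _
      (AddSubgroup.subset_closure (Or.inl ⟨L, (N : ℚ) - 1, (N : ℚ), β, hN1, hNN, hLd,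
        fun y _ => congrFun hLi y, rfl⟩))
      (AddSubgroup.subset_closure (Or.inr ⟨s₀, γ, hs₀, hs₀i, rfl⟩)), ?_⟩
    have : KZ.of r - (KZ.of L + KZ.of s₀) = (KZ.of r - (KZ.of s₁ + KZ.of s₀)) + (KZ.of s₁ - KZ.of L) := by
      abel
    rw [this]
    exact KZ.relations.add_mem h hb
  · exact ⟨KZ.of r, AddSubgroup.subset_closure (Or.inr ⟨r, q, hr, hri, rfl⟩), by simp⟩

/-! ## Plan C — the first CROSS-LEVEL relation in weight two, as a move chain (calibration) -/

/-- **C1 (duplication as rule 2 + rule 1b)**: `[□², 1/(M²−xy)] ≡ 2[□², 1/(M−xy)] − 2[□², 1/(M+xy)]`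
(`Li₂(1/M²) = 2Li₂(1/M) + 2Li₂(−1/M)`): the squaring map `Φ(x,y) = (x², y²)` of the closed cube
onto itself (injective, polynomial, `|det Φ'| = 4xy`) gives `[□², 4xy/(M²−x²y²)]`, and
`4xy/(M²−x²y²) = 2/(M−xy) − 2/(M+xy)` on the cube. [cite: KontsevichZagier2001, §1.2 rule (2)] -/
theorem helper_C1_box_duplication_mem_relations {M : ℕ} (hM : 2 ≤ M) (r s t : IntegralRep 2)
    (hr : r.domain = cube 2) (hri : EqOn r.integrand (fun p => 1 / ((M : ℝ) ^ 2 - p 0 * p 1)) (cube 2))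
    (hs : s.domain = cube 2) (hsi : EqOn s.integrand (fun p => 2 / ((M : ℝ) - p 0 * p 1)) (cube 2))
    (ht : t.domain = cube 2) (hti : EqOn t.integrand (fun p => 2 / ((M : ℝ) + p 0 * p 1)) (cube 2)) :
    KZ.of r - KZ.of s + KZ.of t ∈ KZ.relations := by
  sorry

end Summit.KontsevichZagierPeriods.HermiteRigidity.ReductionRigidity.IslandComplementIdeas2

end
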